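import Summits.KontsevichZagierPeriods.KontsevichZagierPeriods.Theorems.RealOnePeriodRelations.Negative.Kit
import Literature.NumberTheory.Transcendental.KZCalculusProofs
import Literature.NumberTheory.Transcendental.KZSemialgebraicComplex
import Literature.NumberTheory.Transcendental.SemialgebraicLineDeriv

/-!
# `RealOnePeriodRelations` (stmt-KontsevichZagierPeriods-10042), line `nash-retraction-thin-strip`:
# stub `stub_arcSymbols`, auxiliary file 3 — cutting a one-dimensional representation at finitely
# many algebraic points (rule 1a)

For a 1-dimensional Kontsevich–Zagier representation `r` and algebraic reals `a < b` let
`cut r a b = [r|_{dom r ∩ (a,b)}]`. We prove, inside `closure (1a ∪ 2)` (indeed using rule 1a only):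
null pieces vanish (`of_mem_closure_of_null`), `cut r a b ≡ cut r a e + cut r e b` for `a < e < b`
(the point `e` is Lebesgue-null), and by induction on a finite set `E ⊂ (a, b)` of algebraic cut
points: `cut r a b ≡ Σ_{cells} cut r u v`, the cells `(u, v)` being the consecutive open intervals
of `(a, b) ∖ E` (`exists_cells`). Elementary bookkeeping for the piece reduction of the stub
`stub_arcSymbols` [Kontsevich–Zagier 2001, §1.2 rule (1)].

References: M. Kontsevich, D. Zagier, *Periods* (2001), §1.2; J. Bochnak, M. Coste, M.-F. Roy,
*Real Algebraic Geometry* (1998), §2.1.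
-/

noncomputable section

open scoped BigOperators
open Set MeasureTheory
open Literature.NumberTheory.Transcendental
open Literature.ModelTheory.ExponentialFields (IsSemialgebraic)

namespace Summit.KontsevichZagierPeriods.SymplecticScissors.RealOnePeriodRelations

namespace ArcSymbols

/-! ## Intervals with algebraic end points -/

/-- `{z : ℝ¹ | a < z 0 < b}` is `ℚ`-semialgebraic for algebraic `a`, `b`. [cite: BochnakCosteRoy1998, §2.1] -/
theorem isSemialgebraic_IooDom {a b : ℝ} (ha : IsAlgebraic ℚ a) (hb : IsAlgebraic ℚ b) :
    IsSemialgebraic ℚ {z : Fin 1 → ℝ | z 0 ∈ Set.Ioo a b} := by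
  have hu : IsSemialgebraic ℚ (Set.univ : Set (Fin 1 → ℝ)) :=
    Literature.ModelTheory.ExponentialFields.isSemialgebraic_univ
  have hX : IsSemialgebraicFunOn ℚ (Set.univ : Set (Fin 1 → ℝ)) (fun z => z 0) :=
    (isSemialgebraicFunOn_aeval hu (MvPolynomial.X 0)).congr fun z _ => by simp
  have h1 := ((isSemialgebraicFunOn_const_of_isAlgebraic hu ha).fun_sub hX).isSemialgebraic_sep_neg
  have h2 := (hX.fun_sub (isSemialgebraicFunOn_const_of_isAlgebraic hu hb)).isSemialgebraic_sep_neg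
  convert h1.inter h2 using 1
  ext z
  simp [sub_neg]

/-- `{z : ℝ¹ | z 0 = e}` is a Lebesgue-null set. [folklore] -/
theorem volume_setOf_apply_eq (e : ℝ) : volume {z : Fin 1 → ℝ | z 0 = e} = 0 := by
  have hsub : {z : Fin 1 → ℝ | z 0 = e} ⊆ {fun _ : Fin 1 => e} := fun z hz => by
    rw [mem_singleton_iff]
    funext i
    rw [Fin.fin_one_eq_zero i]
    exact hz
  exact measure_mono_null hsub (measure_singleton _)

/-! ## Null pieces and cuts modulo `closure (1a ∪ 2)` -/

/-- A representation on a Lebesgue-null domain lies in `closure (1a ∪ 2)` (rule 1a with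
`σ = σ ∪ σ`). [cite: KontsevichZagier2001, §1.2 rule (1)] -/
theorem of_mem_closure_of_null (r : KZ.IntegralRep 1) (hnull : volume r.domain = 0) :
    KZ.of r ∈ AddSubgroup.closure (KZ.domainAddRel ∪ KZ.changeOfVariablesRel) := by
  have h : KZ.of r - KZ.of r - KZ.of r ∈ AddSubgroup.closure (KZ.domainAddRel ∪ KZ.changeOfVariablesRel) :=
    AddSubgroup.subset_closure (Or.inl ⟨1, r, r, r, (Set.union_self _).symm,
      by rwa [Set.inter_self], fun _ _ => rfl, fun _ _ => rfl, rfl⟩)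
  have h' : KZ.of r - KZ.of r - KZ.of r = -KZ.of r := by abel
  rw [h'] at h
  exact neg_mem_iff.mp h

/-- The CUT `[r|_{dom r ∩ (a,b)}]` of a representation to an open interval with algebraic end
points (the empty representation if an end point is not algebraic). [cite: KontsevichZagier2001, §1.2] -/
def cut (r : KZ.IntegralRep 1) (a b : ℝ) : KZ.IntegralRep 1 := by
  classical
  exact if h : IsAlgebraic ℚ a ∧ IsAlgebraic ℚ b then
    r.restrict (r.domain ∩ {z : Fin 1 → ℝ | z 0 ∈ Set.Ioo a b})
      (r.isSemialgebraic_domain.inter (isSemialgebraic_IooDom h.1 h.2)) Set.inter_subset_left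
  else KZ.IntegralRep.empty 1

/-- The domain of a cut. [folklore] -/
theorem cut_domain (r : KZ.IntegralRep 1) {a b : ℝ} (ha : IsAlgebraic ℚ a) (hb : IsAlgebraic ℚ b) :
    (cut r a b).domain = r.domain ∩ {z : Fin 1 → ℝ | z 0 ∈ Set.Ioo a b} := by
  classical
  unfold cut
  rw [dif_pos ⟨ha, hb⟩]
  rfl

/-- The integrand of a cut. [folklore] -/
theorem cut_integrand (r : KZ.IntegralRep 1) {a b : ℝ} (ha : IsAlgebraic ℚ a) (hb : IsAlgebraic ℚ b) :
    (cut r a b).integrand = r.integrand := by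
  classical
  unfold cut
  rw [dif_pos ⟨ha, hb⟩]
  rfl

/-- Rule 1a as membership in `closure (1a ∪ 2)`. [cite: KontsevichZagier2001, §1.2 rule (1)] -/
theorem sub_sub_mem_closure_of_domainAdd (r r₁ r₂ : KZ.IntegralRep 1)
    (hd : r.domain = r₁.domain ∪ r₂.domain) (hnull : volume (r₁.domain ∩ r₂.domain) = 0)
    (h₁ : EqOn r.integrand r₁.integrand r₁.domain) (h₂ : EqOn r.integrand r₂.integrand r₂.domain) :
    KZ.of r - KZ.of r₁ - KZ.of r₂ ∈ AddSubgroup.closure (KZ.domainAddRel ∪ KZ.changeOfVariablesRel) :=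
  AddSubgroup.subset_closure (Or.inl ⟨1, r, r₁, r₂, hd, hnull, h₁, h₂, rfl⟩)

/-- **Cutting at one interior algebraic point**: `cut r a b ≡ cut r a e + cut r e b` modulo
`closure (1a ∪ 2)` for algebraic `a < e < b` (rule 1a twice; the point `e` is null).
[cite: KontsevichZagier2001, §1.2 rule (1)] -/
theorem cut_split (r : KZ.IntegralRep 1) {a e b : ℝ} (ha : IsAlgebraic ℚ a) (he : IsAlgebraic ℚ e)
    (hb : IsAlgebraic ℚ b) (hae : a < e) (heb : e < b) :
    KZ.of (cut r a b) - KZ.of (cut r a e) - KZ.of (cut r e b) ∈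
      AddSubgroup.closure (KZ.domainAddRel ∪ KZ.changeOfVariablesRel) := by
  -- the null middle piece
  set rP : KZ.IntegralRep 1 := r.restrict (r.domain ∩ {z : Fin 1 → ℝ | z 0 = e})
    (r.isSemialgebraic_domain.inter (isSemialgebraic_setOf_apply_eq_of_isAlgebraic he 0))
    Set.inter_subset_left with hrP
  -- the union of the left piece and the middle point
  set rAP : KZ.IntegralRep 1 := r.restrict (r.domain ∩ {z : Fin 1 → ℝ | z 0 ∈ Set.Ioc a e})
    (by
      have h : r.domain ∩ {z : Fin 1 → ℝ | z 0 ∈ Set.Ioc a e} =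
          r.domain ∩ {z : Fin 1 → ℝ | z 0 ∈ Set.Ioo a e} ∪ r.domain ∩ {z : Fin 1 → ℝ | z 0 = e} := by
        ext z
        simp only [mem_inter_iff, mem_setOf_eq, mem_Ioc, mem_Ioo, mem_union]
        constructor
        · rintro ⟨hz, h1, h2⟩
          rcases h2.lt_or_eq with h | h
          · exact Or.inl ⟨hz, h1, h⟩
          · exact Or.inr ⟨hz, h⟩
        · rintro (⟨hz, h1, h2⟩ | ⟨hz, h⟩)
          · exact ⟨hz, h1, h2.le⟩
          · exact ⟨hz, h ▸ hae, h.le⟩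
      rw [h]
      exact (r.isSemialgebraic_domain.inter (isSemialgebraic_IooDom ha he)).union
        (r.isSemialgebraic_domain.inter (isSemialgebraic_setOf_apply_eq_of_isAlgebraic he 0)))
    Set.inter_subset_left with hrAP
  have hdAB : (cut r a b).domain = rAP.domain ∪ (cut r e b).domain := by
    rw [cut_domain r ha hb, cut_domain r he hb]
    ext z
    simp only [mem_inter_iff, mem_setOf_eq, mem_Ioo, mem_Ioc, mem_union, rAP,
      KZ.IntegralRep.domain_restrict]
    constructor
    · rintro ⟨hz, h1, h2⟩
      rcases le_or_gt (z 0) e with h | h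
      · exact Or.inl ⟨hz, h1, h⟩
      · exact Or.inr ⟨hz, h, h2⟩
    · rintro (⟨hz, h1, h2⟩ | ⟨hz, h1, h2⟩)
      · exact ⟨hz, h1, h2.trans_lt heb⟩
      · exact ⟨hz, hae.trans h1, h2⟩
  have h1 : KZ.of (cut r a b) - KZ.of rAP - KZ.of (cut r e b) ∈
      AddSubgroup.closure (KZ.domainAddRel ∪ KZ.changeOfVariablesRel) := by
    refine sub_sub_mem_closure_of_domainAdd _ _ _ hdAB ?_ (fun z _ => ?_) (fun z _ => ?_)
    · have hem : rAP.domain ∩ (cut r e b).domain = ∅ := by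
        rw [cut_domain r he hb]
        ext z
        simp only [mem_inter_iff, mem_setOf_eq, mem_Ioo, mem_Ioc, mem_empty_iff_false, iff_false,
          rAP, KZ.IntegralRep.domain_restrict]
        rintro ⟨⟨-, -, h2⟩, -, h3, -⟩
        exact absurd (h2.trans_lt h3) (lt_irrefl _)
      rw [hem, measure_empty]
    · rw [cut_integrand r ha hb]; rfl
    · rw [cut_integrand r ha hb, cut_integrand r he hb]
  have h2 : KZ.of rAP - KZ.of (cut r a e) - KZ.of rP ∈
      AddSubgroup.closure (KZ.domainAddRel ∪ KZ.changeOfVariablesRel) := by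
    refine sub_sub_mem_closure_of_domainAdd _ _ _ ?_ ?_ (fun z _ => ?_) (fun z _ => ?_)
    · rw [cut_domain r ha he]
      ext z
      simp only [mem_inter_iff, mem_setOf_eq, mem_Ioo, mem_Ioc, mem_union, rAP, rP,
        KZ.IntegralRep.domain_restrict]
      constructor
      · rintro ⟨hz, h1, h2⟩
        rcases h2.lt_or_eq with h | h
        · exact Or.inl ⟨hz, h1, h⟩
        · exact Or.inr ⟨hz, h⟩
      · rintro (⟨hz, h1, h2⟩ | ⟨hz, h⟩)
        · exact ⟨hz, h1, h2.le⟩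
        · exact ⟨hz, h ▸ hae, h.le⟩
    · refine measure_mono_null Set.inter_subset_right ?_
      exact measure_mono_null Set.inter_subset_right (volume_setOf_apply_eq e)
    · rw [cut_integrand r ha he]; rfl
    · rfl
  have h3 : KZ.of rP ∈ AddSubgroup.closure (KZ.domainAddRel ∪ KZ.changeOfVariablesRel) :=
    of_mem_closure_of_null rP (measure_mono_null Set.inter_subset_right (volume_setOf_apply_eq e))
  have h := add_mem (add_mem h1 h2) h3
  have he' : KZ.of (cut r a b) - KZ.of rAP - KZ.of (cut r e b) +
      (KZ.of rAP - KZ.of (cut r a e) - KZ.of rP) + KZ.of rP =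
      KZ.of (cut r a b) - KZ.of (cut r a e) - KZ.of (cut r e b) := by abel
  rwa [he'] at h

/-- **Cutting at finitely many algebraic points.** For a finite set `E ⊂ (a, b)` of algebraic
points (`a < b` algebraic) there is a finite set of CELLS `(u, v)` — consecutive points of
`{a} ∪ E ∪ {b}`: `a ≤ u < v ≤ b`, `u, v` algebraic, `u ∈ {a} ∪ E`, `v ∈ E ∪ {b}`, no point of `E`
inside `(u, v)` — with `cut r a b ≡ Σ_cells cut r u v` modulo `closure (1a ∪ 2)` (induction on `E`,
cutting at its least element). [cite: KontsevichZagier2001, §1.2 rule (1)] -/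
theorem exists_cells (r : KZ.IntegralRep 1) (E : Finset ℝ) (hE : ∀ e ∈ E, IsAlgebraic ℚ e) :
    ∀ a b : ℝ, IsAlgebraic ℚ a → IsAlgebraic ℚ b → a < b → (∀ e ∈ E, e ∈ Set.Ioo a b) →
      ∃ cells : Finset (ℝ × ℝ),
        (∀ c ∈ cells, a ≤ c.1 ∧ c.1 < c.2 ∧ c.2 ≤ b ∧ IsAlgebraic ℚ c.1 ∧ IsAlgebraic ℚ c.2 ∧
          (c.1 = a ∨ c.1 ∈ E) ∧ (c.2 = b ∨ c.2 ∈ E) ∧ ∀ x ∈ E, x ∉ Set.Ioo c.1 c.2) ∧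
        KZ.of (cut r a b) - ∑ c ∈ cells, KZ.of (cut r c.1 c.2) ∈
          AddSubgroup.closure (KZ.domainAddRel ∪ KZ.changeOfVariablesRel) := by
  classical
  induction E using Finset.induction_on_min with
  | empty =>
    intro a b ha hb hab _
    refine ⟨{(a, b)}, fun c hc => ?_, ?_⟩
    · rw [Finset.mem_singleton] at hc
      subst hc
      exact ⟨le_rfl, hab, le_rfl, ha, hb, Or.inl rfl, Or.inl rfl, fun x hx => by simp at hx⟩
    · rw [Finset.sum_singleton, sub_self]
      exact zero_mem _
  | insert e s hlt ih =>
    intro a b ha hb hab hmem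
    have he : IsAlgebraic ℚ e := hE e (Finset.mem_insert_self e s)
    have heab : e ∈ Set.Ioo a b := hmem e (Finset.mem_insert_self e s)
    obtain ⟨cells, hcells, hsum⟩ := ih (fun x hx => hE x (Finset.mem_insert_of_mem hx)) e b he hb
      heab.2 fun x hx => ⟨hlt x hx, (hmem x (Finset.mem_insert_of_mem hx)).2⟩
    have hnot : (a, e) ∉ cells := fun h => by
      have := (hcells _ h).1
      exact absurd this (not_le.mpr heab.1)
    refine ⟨insert (a, e) cells, fun c hc => ?_, ?_⟩
    · rw [Finset.mem_insert] at hc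
      rcases hc with rfl | hc
      · refine ⟨le_rfl, heab.1, heab.2.le, ha, he, Or.inl rfl, Or.inr (Finset.mem_insert_self e s),
          fun x hx hxI => ?_⟩
        rw [Finset.mem_insert] at hx
        rcases hx with rfl | hx
        · exact lt_irrefl _ hxI.2
        · exact absurd (hlt x hx) (not_lt.mpr hxI.2.le)
      · obtain ⟨h1, h2, h3, h4, h5, h6, h7, h8⟩ := hcells c hc
        refine ⟨heab.1.le.trans h1, h2, h3, h4, h5, ?_, ?_, fun x hx hxI => ?_⟩
        · rcases h6 with h | h
          · exact Or.inr (h ▸ Finset.mem_insert_self e s)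
          · exact Or.inr (Finset.mem_insert_of_mem h)
        · rcases h7 with h | h
          · exact Or.inl h
          · exact Or.inr (Finset.mem_insert_of_mem h)
        · rw [Finset.mem_insert] at hx
          rcases hx with rfl | hx
          · exact absurd (h1.trans_lt hxI.1) (lt_irrefl _)
          · exact h8 x hx hxI
    · rw [Finset.sum_insert hnot]
      have h := add_mem (cut_split r ha he hb heab.1 heab.2) hsum
      have h' : KZ.of (cut r a b) - KZ.of (cut r a e) - KZ.of (cut r e b) +
          (KZ.of (cut r e b) - ∑ c ∈ cells, KZ.of (cut r c.1 c.2)) =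
          KZ.of (cut r a b) - (KZ.of (cut r a e) + ∑ c ∈ cells, KZ.of (cut r c.1 c.2)) := by abel
      rwa [h'] at h

/-- A representation on `(a, b)` is its own cut: `[r] ≡ cut r a b` modulo `closure (1a ∪ 2)`
(rule 1a with an empty second piece). [cite: KontsevichZagier2001, §1.2 rule (1)] -/
theorem of_sub_of_cut_mem (r : KZ.IntegralRep 1) {a b : ℝ} (ha : IsAlgebraic ℚ a) (hb : IsAlgebraic ℚ b)
    (hdom : r.domain = {z : Fin 1 → ℝ | z 0 ∈ Set.Ioo a b}) :
    KZ.of r - KZ.of (cut r a b) ∈ AddSubgroup.closure (KZ.domainAddRel ∪ KZ.changeOfVariablesRel) := by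
  have h1 : KZ.of r - KZ.of (cut r a b) - KZ.of (KZ.IntegralRep.empty 1) ∈
      AddSubgroup.closure (KZ.domainAddRel ∪ KZ.changeOfVariablesRel) := by
    refine sub_sub_mem_closure_of_domainAdd _ _ _ ?_ (by simp) (fun z _ => ?_) (fun z hz => ?_)
    · rw [cut_domain r ha hb, KZ.IntegralRep.domain_empty, Set.union_empty, ← hdom, Set.inter_self]
    · rw [cut_integrand r ha hb]
    · exact absurd hz (Set.notMem_empty _)
  have h2 : KZ.of (KZ.IntegralRep.empty 1) ∈ AddSubgroup.closure (KZ.domainAddRel ∪ KZ.changeOfVariablesRel) :=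
    of_mem_closure_of_null _ (by simp)
  have h := add_mem h1 h2
  rwa [sub_add_cancel] at h

end ArcSymbols

/-- **Registered anchor `helper_arcSymbols_3`** (a representation on a Lebesgue-null domain lies in
`closure (1a ∪ 2)`). [cite: KontsevichZagier2001, §1.2 rule (1)] -/
theorem helper_arcSymbols_3 : ∀ (r : KZ.IntegralRep 1), MeasureTheory.volume r.domain = 0 → KZ.of r ∈ AddSubgroup.closure (KZ.domainAddRel ∪ KZ.changeOfVariablesRel) :=
  ArcSymbols.of_mem_closure_of_null

end Summit.KontsevichZagierPeriods.SymplecticScissors.RealOnePeriodRelations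

end
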